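import Summits.BirchSwinnertonDyer.Rank1Residual.F1Sign2.GenusClassSwitchingAtTwo
import HarnessLib.Audit.Tags
import HarnessLib

/-!
# Cell `bsd-f1-sign2` — descent / visibility lens (planner `-desc` g25; MEMO-desc §34 + §34-add1): DESC-34 «THE RESIDUAL ± BIT AT A ν = 0 SPLIT PRIME OF 446a1 IS AN
# S₃-SPIN × A FROBENIAN COFACTOR» (vocabulary `IsCurve446a1`, `cubic446`, `quarticT3`, `xnum446`, `unitOne446`, `unitTwo446`, `evalMod`, `evalRealZ`, `LabelledRootsMod`,
# `GeneratesPrimeOver`, `UnitsSquareModPrimesOver`, `Curve446NuZeroSplitMember`, `KappaZeroAtSplit`, `SpinBitAtSplit`; rows DESC-34-S `Curve446SplitPrimePureSpinLaw`,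
# DESC-34-SF `Curve446SplitPrimeSpinTimesFrobenian`, DESC-34-SF8 `Curve446SplitPrimeSpinTimesFrobenianModEight` + glue `spinTimesFrobenian_of_modEight`, DESC-34-NG
# `Curve446SplitPrimeKappaNotGoverned`, DESC-34-ν `Cubic446NuZeroLaw`, DESC-34-S_an `Curve446SplitPrimePureSpinShaAnLaw` + glue `curve446PureSpinShaAnLaw_of_spinLaw_of_parity`;
# REF1 §208's kernel certificates K208.1–12 for §34 AND §35 live in the sibling `SpinLawAtTwoKernel.lean`, the §35 breadth rows in `GenusTrivialSpinLawAtTwo.lean`)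

STATEMENTS + -desc's two glue theorems (typer -ty g19).  Source: `HOME/MEMO-desc-data/g25/lean/Sketch34v2.lean` **0f4540ed9500a3a5** (243 l., ns flat `…F1Sign2`; = the text REF1
audited in §208, `HOME/REF1-data/b208/Sketch34v2.lean`, and Part A of REF1's `Probe208.lean` **d651f3415836a4c9** VERBATIM under `…F1Sign2.REF1s208`; farm rc 0, sorries = exactly the
10 probes, K208.1–12 std axioms; -desc's BC7 `bc7_34v2.out` / `bc7_34v2_sf8.out` fired = []).  PORT GATE = REF1-AUDIT §208 R208a (INBOX 2026-08-29T15:39:37Z): Props VERBATIM from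
0f4540ed9500a3a5; tags 34-S / 34-SF / 34-SF8 / 34-NG / 34-S_an `@[conjecture]`, 34-ν plain — all as sketched; the §34 and §35 files are KEPT APART (all names distinct; §34's
carriers are the `c = cubic446`, `xnum = xnum446`, `xden = 4` instances of §35's — `evalMod` and §35's `evalModC` have the same body, kernel lemma `evalModC_eq_evalMod`).
ONE FORCED RENAME (typer, `dedup.fqn-exists`): -desc's `evalReal (g : ℤ[X]) (x : ℝ)` ↦ **`evalRealZ`** — `Summit.BirchSwinnertonDyer.Rank1Residual.F1Sign2.evalReal` is ALREADY a
tree declaration (`F1Sign2/HalfPeriodWeilPairingAtTwo.lean` l.138, on `Polynomial ℚ`, -ty g1x); every occurrence in SF / SF8 / NG / ν and in the glue is renamed, nothing else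
(builder-verified: bodies = sketch = Probe208 byte-for-byte modulo exactly this token).  `IsCurve446a1 W` (the a-invariant conjunction) vs the inline binders `W.a₁ = 1 → … →
W.a₆ = 52 →` of the landed §33 rows `Curve446SplitCofactorLegendreLaw` / `Curve446SplitPrimeNuZeroLaw` (`GenusClassSwitchingAtTwo.lean` l.309/l.333; R208a «use ONE form
tree-wide»): the landed statements cannot be re-typed and the audited §34 rows are filed verbatim, so the kernel file carries the bridge `isCurve446a1_iff` / `IsCurve446a1.elim`
(definitional) — one notion, two spellings, kernel-linked.  Carriers `TwistSupportGoodOdd`, `FrobTwoSplitAt`, `FrobTwoInvolutionAt`, `QuarticRootlessMod`,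
`QuarticTotallySplitMod`, `OneInvolutionOneSplitRestCycles` and DESC-33-P `TwistShaAnOddIffSelmerTrivialAtTwo` are the landed §33 declarations (imported; v2 of the sketch no
longer re-declares them).  CITE TAGS (typer): -desc's multi-key brackets split one key per tag; FIMR locators in arXiv numbering per REF2 v54 §11.2 («Thm. 11.1 (= arXiv Thm. 28)»;
-desc's «Prop. 12.4» = arXiv Prop. 31 in §12 «Prime spins for an involution» — nobody here holds the Inventiones pagination); `MazurRubin2010 §3` given its comma.
GRADES (REF1-AUDIT §208, `HOME/REF1-AUDIT-v1.md`; evidence `HOME/REF1-data/b208/` SHA16.txt: `spin_retally.py` b078b02d22e51372 → `retally.txt`, `ngwit208.py/.txt`, `nu208.py/.txt`,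
`nu2_208.py/.txt`, `alg208.py/.txt`): **0 KILLED · all §34 rows SURVIVE** — 34-S `@[conjecture]` THEOREM-CANDIDATE by §35-add1's descent (BC5 76/76 re-tallied; the binders `i ≠ j`
(K208.2: on the diagonal the spin predicate is `IsSquare 0` = True), purity (K208.3: contains `p ≢ 3 (4)`; among IMPURE primes the spin bit is label-MIXED at 32 197 vs consistent
at 14 781 — dropping purity is refuted ~2:1) and NG's `0 < N` are LOAD-BEARING and present); 34-SF / 34-SF8 (+ glue K208.8) `@[conjecture]` (Φ well-defined: the only unit
classes ≡ □ mod 4𝓞_L are 1 and u₁u₂, and u₁u₂ is not totally positive; ENGINE 49 SF 746/746 and ENGINE 49b PHI 4 325/4 325 are -desc's tallies, NOT re-tallied by REF1); 34-NG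
`@[conjecture]` (the 24 printed ∃-witnesses for `N ∣ 128` verified 24/24 — `p ≡ p′ (N)`, exact resultants, congruent generator triples, total positivity certified at 700 digits,
`κ₀(p) ≠ κ₀(p′)`; the `∀ N` row is KM-type and its analytic input is OPEN IN PRINT for this field); **34-ν THEOREM-GRADE support** (plain; conjunct 1 «`T₃` totally split ⟺ `u₁u₂`
□ at the three roots» 2 977/2 977 = -desc; conjunct 2 (NEW REF1 test) 2 977/2 977; **conjunct 2 ⟸ conjunct 1 by class field theory: among the 7 non-trivial classes of
`⟨−1,u₁,u₂⟩ ↠ 𝓞_L^×/𝓞_L^{×2}` exactly `u₁u₂ = 77 − 32θ − 20θ² ≡ 1 (mod 4𝓞_L)` is a square mod 4, so `L(√(u₁u₂))/L` is unramified at all finite primes and ramified at the two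
real places where `u₁u₂ < 0`; with `h_L = 1`, `h⁺_L = 2`, `L(√(u₁u₂))` IS the narrow Hilbert class field** (REF1 §208 C4) — what remains for conjunct 1 as a theorem is the descent
identity class(`T₃`) = `u₁u₂` in `(L^×/L^{×2})_{N=□}`); 34-S_an + glue (K208.9) `@[conjecture]`.  EXACT DATA for readers (REF1 §208 C4, R208b(iv)): the Mordell–Weil Kummer class
of 446a1 is a DIFFERENT unit class — `δ(P) = X(P) − Θ = 58 − 2θ − 7θ²` with `δ(P)·u₁ = (6 − 2θ − θ²)²` (`P = (4,2)`), i.e. `Sel₂(446a1) = {1, u₁}`; so the constant switching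
class `s₃` of §33 is `u₁u₂`, not the Mordell–Weil class (at split `p < 4 000` «`u₁` □ at all roots» agrees with `ν = 0` only 60/83).  Carriers (A2): `cubic446` = polredabs cubic of
`ℚ(446a1[2])`, field disc 892 = 4·223, `ℤ[θ] = 𝓞_L`; `Res(cubic446, xnum446) = −3328 = −F(0)` for the monic model `F = X³ + 5X² − 480X + 3328` of `[1,1,0,−30,52]`; `u₁, u₂` of
norm +1, `u₁ ≻ 0`, `u₂` signs (+,−,−) at the real roots −2.9173 < 1.3196 < 2.5977; `GeneratesPrimeOver p a g` ⟹ `(g(θ)) = 𝔭_a` exactly; `KappaZeroAtSplit`'s ℕ-division `n / p` is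
exact inside the member predicate (K208.5′); labels pairwise distinct (K208.7) and `p ∉ {2, 223}` silently (separability); `p = 2` labellings do not exist (K208.1).  (A3) vacuity:
every hypothesis bundle is inhabited by the census rows themselves (34-S at `p = 997`); `OnOddBranchRankOneAtTwo 446a1` is the inherited F1Sign2 population predicate (asserted by
ENGINE 31/34, not kernel-proved — R196-type caveat).  K208.12: `SpinSetting W → OnOddBranchRankOneAtTwo W → False` — the §34 (446a1, rank 1) and §35 (rank-0 type) populations are
DISJOINT; both files are needed.
REF2-PLACEMENT v54 §11 (OWED (2) served; 11.0: v53 §22 PREDICTION #2 «residual κ = FIMR spin in the cubic field, S₃ form, with Frobenian corrections» CONFIRMED by ENGINE 49, #3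
withdrawn; one v53 §22.3 sentence WITHDRAWN: no equidistribution theorem in print covers this non-Galois field with `U⁺ ≠ U²`): **DESC-34-S / SF / SF8 = NEW-COMBINATION**,
THEOREM-CANDIDATES by descent (no BSD input) — load-bearing lever = spin ↔ Selmer-Lagrangian link, prior use on this problem Friedlander–Iwaniec–Mazur–Rubin 2013 Thm. 11.1 (= arXiv
Thm. 28: `K = ℚ(E[2])` CYCLIC cubic, prime twists, `π ≻ 0`, `π ≡ □ mod Σ`, cofactor ≡ 0); delta = S₃/non-Galois cubic + composite twists on a kill branch + explicit cofactor + no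
positivity/congruence normalisation; the identity itself is descent bookkeeping (P48 frame + Poitou–Tate + Kramer/Mazur–Rubin local conditions at 2, 223, ∞ + tame symbol — every
ingredient print); WHY the cofactor is a ray-class function mod `8·∞` with `223 ∤` modulus: in the S₃-closure the 3-CYCLE spin is the non-Frobenian content, the transposition spins
are FIMR Prop. 31-type; statement NOT IN PRINT (corpus fts / vsearch / galaxy: FIMR, Koymans–Milovic, Milovic 16-rank only); **DESC-34-NG = conjecture**, shape Koymans–Milovic Thm. 3
(no governing field for the 16-rank of `ℚ(√−4p)`, conditional on `C_n`) / FIMR Thm. 2, analytic input OPEN IN PRINT (FIMR needs cyclic, KM Thm. 1 needs Galois AND the unit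
condition); KM's averaged spin `s_𝔞` is the suggested analytic route; **DESC-34-ν = class field theory** (print/CFT-grade; the identification `s₃ = u₁u₂·□` is the cell's datum).
BC5 (MEMO-desc §34, `HOME/MEMO-desc-data/g25/`): ENGINE 49 = kit j331923/j332000/j332044/j332238 (two engines per prime: PARI `ellrank` on two members AND the relaxed Selmer frame in
`L(S,2)` by `ell2cover` + `bnfsunit`): pure ν = 0 split `p ≤ 3000` = 997, 1109, 2957 law 3/3 on all six `(i,j)`; general identity with cofactor 14/14 (`p ≤ 3000`), 746/746
(`p ≤ 200 000`), `w_i ∈ ⟨u₁,u₂⟩` 2 238/2 238, reciprocity 192/192; ENGINE 49b `an49b/ng49.py`: PHI test 4 325/4 325 at `N = 8` (2 122, 1 026, 505 at 16, 32, 64); NG collision classes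
4/59/117/214/364/504 for `N = 4…128`, `κ₀` differing on 44 706/2 753/1 376/688/338/166 same-class pairs (≈ 50 % = coin).  Cheapest falsifier (34-S): a pure `p` at which the relaxed
class `α_i` has odd valuation at a prime over 2 or 223 (`w_i ∉ ⟨u₁,u₂⟩`; seen 0/42).  R208b (-desc: 13/13-type hygiene n/a; (iii) add the Chebotarev «both cofactor signs realised»
sentence; (iv) exact data above; (vi) SF/PHI/collision counts not re-tallied) and R208d (kernel targets: 34-ν conjunct 1 ⟹ 2 needs CFT infrastructure not in the tree — support row;
the parity ⟹ position enumeration is K208.6 — done; the Poitou–Tate wrapper is the real work) are recorded on the rows.  Why novel (one sentence, -desc §34.7 + REF2 §11.2): nothing in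
print joins {S₃ cubic} × {spin of conjugate primes} × {composite twists}; the first BSD₂-facing bit of this cell shown to be of spin type.  PARTITION none.  Beyond-print theorem: no
(S/SF8 would be beyond-print DESCENT theorems once proved — not BSD).  BSD is not proved; 23715 not closed.  bears_on: stmt-BirchSwinnertonDyer-23715.

## -desc's module docstring of `Sketch34v2.lean` (verbatim; cite brackets re-keyed by the typer)

# Sketch34 — cell bsd-f1-sign2, seat -desc g25 (LENS descent / visibility), MEMO-desc §34

**THE RESIDUAL ± BIT AT A SPLIT PRIME IS AN `S₃`-SPIN.**  `W = 446a1 = [1,1,0,−30,52]` (rank-one odd branch, `Gal(ℚ(W[2])/ℚ) = S₃`), cubic field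
`L = ℚ(θ)`, `θ³ − θ² − 8θ + 10 = 0` (`disc L = 892 = 4·223`, `h_L = 1`, `ℤ[θ] = 𝓞_L`, three real places, fundamental units `u₁ = θ² + θ − 3`
(totally positive) and `u₂ = −3θ² − 5θ + 11`; the x-coordinate of a 2-torsion point is `e = (7θ² + 2θ − 42)/4`).  On the 2-RAMIFIED genus
classes `X3 ∪ X7` (`−n ≡ 3, 7 (8)`, `(−n/223) = +1`) take the members `n = r·p·m` with ONE involution factor `r` killing the constant class `s₃`
(`T₃ = x⁴ − x³ − x² + 2` rootless mod `r`), ONE split factor `p` with `ν(p) = 0` (`T₃` has four roots mod `p`) and 3-cycle cofactor `m`.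
§33-add1h/i (g24, PARI `ellrank`, law P48): `dim Sel₂(W^{(−n)})/2 = κ₀(p) ⊕ [(rm/p) = −1]` with `κ₀(p) ∈ {0,1}` depending on `p` ONLY — the
position of the relaxed-at-`p` Lagrangian; ENGINE 47 (g24) refuted every governing field for `p ↦ κ₀(p)` that was tried (K33).

§34 (g25, ENGINE 49 = kit j331923/j332000/j332044, two engines per prime: `ellrank` on two members AND an independent computation of the
relaxed Selmer frame in `L(S,2)` by `ell2cover` + `bnfsunit`): write `p𝓞_L = 𝔭₁𝔭₂𝔭₃`, `𝔭_j = (p, θ − a_j)`, `π_i` ANY generator of `𝔭_i`.  Then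
(parity lemma + Poitou–Tate in the local frame at `p`) for every `i ≠ j`
  `κ₀(p) = 1 + {(−1/p)} + {(π_i/𝔭_j)} + {((e_i − e_j)/p)} + {(η·w_i/𝔭_j)}   (mod 2)`,
where `(π_i/𝔭_j) = (g_i(a_j)/p)` for `π_i = g_i(θ)` is a quadratic residue symbol between CONJUGATE primes of the non-Galois cubic field — an
`S₃`-SPIN in the sense of Friedlander–Iwaniec–Mazur–Rubin — and the cofactor `(η w_i/𝔭_j)` (`η = p/(π₁π₂π₃)`, `w_i ∈ ⟨u₁,u₂⟩` the unit making
`π_j π_k w_i` satisfy the local conditions at `2, 223, ∞`) is a FROBENIAN function of the ray classes of `𝔭₁, 𝔭₂, 𝔭₃` modulo `1784·∞`.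
Rows: DESC-34-S `Curve446SplitPrimePureSpinLaw` (the law on the PURE subfamily where the cofactor vanishes: every unit of `𝓞_L` is a square modulo
every prime over `p`), DESC-34-SF `Curve446SplitPrimeSpinTimesFrobenian` (general `ν = 0` split `p`: `κ₀ ⊕ spin` is ray-class Frobenian),
DESC-34-NG `Curve446SplitPrimeKappaNotGoverned` (`@[conjecture]`: `κ₀` itself is governed by NO ray class group of `L` — the `S₃` analogue of
Koymans–Milovic's "no governing field for the 16-rank"), DESC-34-ν `Cubic446NuZeroLaw` (support: `ν(p) = 0 ⟺ u₁u₂` is a square mod every prime over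
`p ⟺` the three primes over `p` are narrowly principal), DESC-34-S_an (analytic twin of S via DESC-33-P) + kernel glue.
Nearest print: [cite: FIMR2013Spin, Thm. 11.1 (= arXiv 1110.6331 Thm. 28)] (`K = ℚ(E[2])` CYCLIC cubic, PRIME twists `E^{(p)}`, `p` split in `ℚ(E[4])`,
`π ≡ □ (mod Σ)`: `dim Sel₂(E^{(p)}) = dim Sel₂(E) + 2·[spin(𝔭,σ) = +1]`); [cite: KoymansMilovic2021Spins, Thm. 1] (joint spins, any Galois `K/ℚ` with
`U⁺ = U²`, conditional on `C_n`).  Here: `S₃` (non-Galois cubic), COMPOSITE twists on a kill branch, unit group of sign rank 2 (`U⁺_L ≠ U_L²`, so the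
FIMR/KM normalisation is unavailable and the law is stated generator-free), and the Selmer side is the RESIDUAL bit after the Mazur–Rubin switches.
-/

noncomputable section

open scoped Classical

open WeierstrassCurve Literature.NumberTheory.EllipticCurves Polynomial

namespace Summit.BirchSwinnertonDyer.Rank1Residual.F1Sign2

/-! ### Carriers: `TwistSupportGoodOdd`, `FrobTwoSplitAt`, `FrobTwoInvolutionAt`, `QuarticRootlessMod`, `QuarticTotallySplitMod`,
`OneInvolutionOneSplitRestCycles` and DESC-33-P `TwistShaAnOddIffSelmerTrivialAtTwo` are OPENED BY NAME from the landed
`F1Sign2/GenusClassSwitchingAtTwo.lean` (p724225, -ty g18) — v2 of this sketch no longer re-declares them (typer lint rule). -/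

/-! ### §34 vocabulary: the cubic field of `446a1` in elementary (polynomial) form -/

/-- `W` is the minimal model `[1,1,0,−30,52]` of `446a1`.
(Typer -ty g19: carrier VERBATIM (`[1,1,0,−30,52]`: REF1 §196/§208 recomputed `b₂ = 5, b₄ = −60, b₆ = 208`, `Δ = 2⁶·223`, minimal).  R208a «ONE form tree-wide»: the landed §33 rows
`Curve446SplitCofactorLegendreLaw` / `Curve446SplitPrimeNuZeroLaw` spell the same five equations as inline binders; the kernel file's `isCurve446a1_iff` / `IsCurve446a1.intro_of`
bridge the two spellings definitionally.) -/
def IsCurve446a1 (W : WeierstrassCurve ℚ) : Prop :=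
  W.a₁ = 1 ∧ W.a₂ = 1 ∧ W.a₃ = 0 ∧ W.a₄ = -30 ∧ W.a₆ = 52

/-- Defining polynomial of the cubic field `L = ℚ(W[2]) ∩ ℝ`-conjugates of `446a1` (`polredabs` of the 2-division field): `θ³ − θ² − 8θ + 10`;
`ℤ[θ] = 𝓞_L`, `disc = 892`, `h_L = 1`.
(Typer: datum VERBATIM; REF1 §208 (A2): polredabs cubic of `ℚ(446a1[2])`, field disc 892 = 4·223, `ℤ[θ] = 𝓞_L` since 223 ≡ 3 (4) is not a discriminant; `−Res(c, c′) = 892`.) -/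
def cubic446 : ℤ[X] := X ^ 3 - X ^ 2 - 8 * X + 10

/-- The 2-covering quartic of the constant Selmer class `s₃` of the classes `X3 ∪ X7` (Sketch33).
(Typer: datum VERBATIM (= the landed §33 inline quartic `X ^ 4 - X ^ 3 - X ^ 2 + 2` of `Curve446SplitCofactorLegendreLaw`); `disc T₃`-normalised = 892 (REF1 C3).) -/
def quarticT3 : ℤ[X] := X ^ 4 - X ^ 3 - X ^ 2 + 2

/-- `4e = 7θ² + 2θ − 42`: four times the x-coordinate of the 2-torsion point of `[1,1,0,−30,52]` defined over `L` (`e` a root of `4x³ + 5x² − 120x + 208`).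
(Typer: datum VERBATIM; REF1 §208 (A2): `Θ = 4e`, `Res(cubic446, xnum446) = −3328 = −F(0)` for the monic model `F = X³ + 5X² − 480X + 3328` of 446a1 ✓; the factor 4 is a square, so
spin symbols are unchanged.) -/
def xnum446 : ℤ[X] := 7 * X ^ 2 + 2 * X - 42

/-- Fundamental unit `u₁ = θ² + θ − 3` of `ℤ[θ]` (norm `+1`, totally positive).
(Typer: datum VERBATIM; REF1: norm +1, totally positive (2.59, 0.064, 6.35 at the real roots); the Mordell–Weil Kummer class of 446a1 is `u₁` (`δ(P)·u₁ = (6 − 2θ − θ²)²`, R208b(iv)).) -/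
def unitOne446 : ℤ[X] := X ^ 2 + X - 3

/-- Fundamental unit `u₂ = −3θ² − 5θ + 11` of `ℤ[θ]` (norm `+1`, signs `(+,−,−)` at the real places `θ ≈ −2.917, 1.320, 2.598`).
(Typer: datum VERBATIM; REF1: norm +1, signs (+,−,−) at −2.9173 < 1.3196 < 2.5977; `⟨−1,u₁,u₂⟩ ↠ 𝓞_L^×/𝓞_L^{×2}` (all 7 non-trivial products non-squares), so «purity over
{−1,u₁,u₂}» = «purity over ALL units»; `u₁u₂ = 77 − 32θ − 20θ² ≡ 1 (mod 4𝓞_L)` — `L(√(u₁u₂))` = narrow Hilbert class field (REF1 §208 C4).) -/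
def unitTwo446 : ℤ[X] := -3 * X ^ 2 - 5 * X + 11

/-- Reduction of an integer polynomial at `x ∈ ℤ/p`.
(Typer: carrier VERBATIM; §35's `evalModC` has the same body — kernel lemma `evalModC_eq_evalMod`.) -/
def evalMod (g : ℤ[X]) (p : ℕ) (x : ZMod p) : ZMod p :=
  (g.map (Int.castRingHom (ZMod p))).eval x

/-- Real evaluation of an integer polynomial.
(Typer -ty g19: carrier VERBATIM but for its NAME — -desc's `evalReal` ↦ `evalRealZ`, forced: `…F1Sign2.evalReal` already exists in the tree (`HalfPeriodWeilPairingAtTwo.lean`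
l.138, on `Polynomial ℚ`); every use below renamed, nothing else.) -/
def evalRealZ (g : ℤ[X]) (x : ℝ) : ℝ :=
  (g.map (Int.castRingHom ℝ)).eval x

/-- A LABELLING of the three primes over a totally split `p`: `a : Fin 3 → ℤ/p` injective with `cubic446(a_j) = 0`; `𝔭_j := (p, θ − a_j)`.
(Typer: carrier VERBATIM; K208.1: no labelling exists at `p = 2` (`Fin 3 ↛ ZMod 2`); K208.7: labels pairwise distinct, hence `cubic446` separable mod `p` and
`p ∉ {2, 223}` silently — intended.) -/
def LabelledRootsMod (p : ℕ) (a : Fin 3 → ZMod p) : Prop :=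
  Function.Injective a ∧ ∀ j, evalMod cubic446 p (a j) = 0

/-- `g(θ)` GENERATES the prime `(p, θ − a)` of `ℤ[θ]`: `deg g ≤ 2`, `|N_{L/ℚ}(g(θ))| = |Res(cubic446, g)| = p` and `g(a) ≡ 0 (mod p)`.
(Typer: carrier VERBATIM; REF1 (A2): `deg g ≤ 2 ∧ |Res(c,g)| = p ∧ g(a) = 0` ⟹ `(g(θ)) = 𝔭_a` exactly.) -/
def GeneratesPrimeOver (p : ℕ) (a : ZMod p) (g : ℤ[X]) : Prop :=
  g.natDegree ≤ 2 ∧ (Polynomial.resultant cubic446 g).natAbs = p ∧ evalMod g p a = 0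

/-- PURITY at `p`: every unit of `𝓞_L = ℤ[θ]` (group `⟨−1, u₁, u₂⟩`) is a square modulo each of the three primes over `p`.
(Typer: carrier VERBATIM; K208.3: contains `IsSquare (−1)`, so `p % 4 ≠ 3` — all pure primes of the tables are ≡ 1 (4) ✓.) -/
def UnitsSquareModPrimesOver (p : ℕ) (a : Fin 3 → ZMod p) : Prop :=
  IsSquare (-1 : ZMod p) ∧ ∀ j, IsSquare (evalMod unitOne446 p (a j)) ∧ IsSquare (evalMod unitTwo446 p (a j))

/-- The member `n = r·p·m` of the `ν = 0` SPLIT CELL of `446a1`: good odd squarefree support, class `X3 ∪ X7` (`−n ≡ 3,7 (8)`, `(−n/223) = +1`),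
one involution factor `r` with `T₃` rootless mod `r` (kill branch), one split factor `p` with `T₃` totally split mod `p` (`ν(p) = 0`), 3-cycle cofactor.
(Typer: carrier VERBATIM over the landed §33 carriers; K208.5′: `n / p * p = n` inside it (the ℕ-division of `KappaZeroAtSplit` is exact).) -/
def Curve446NuZeroSplitMember (W : WeierstrassCurve ℚ) [W.IsGloballyMinimal] (n r p : ℕ) : Prop :=
  TwistSupportGoodOdd W n ∧ ((-(n : ℤ)) % 8 = 3 ∨ (-(n : ℤ)) % 8 = 7) ∧ jacobiSym (-(n : ℤ)) 223 = 1 ∧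
    OneInvolutionOneSplitRestCycles W n r p ∧ QuarticRootlessMod quarticT3 r ∧ QuarticTotallySplitMod quarticT3 p

/-- THE INTRINSIC LAGRANGIAN BIT `κ₀(p) = 1`, read through the member `n = r·p·m` (law P48, §33-add1i: `Sel₂(W^{(−n)}) = 0 ⟺ κ₀(p) ≠ [(rm/p) = +1]`,
so `κ₀(p) = 1 ⟺ (Sel₂ = 0 ⟺ (n/p · / p) = −1)`; member-independence of the right side is part of every law below).
(Typer: carrier VERBATIM; ℕ-division `n / p` harmless — read only inside the member predicates where `p ∣ n` (K208.5/5′).) -/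
def KappaZeroAtSplit (W : WeierstrassCurve ℚ) (n p : ℕ) : Prop :=
  twistSelmerTwoCard W (-(n : ℤ)) = 1 ↔ jacobiSym ((n / p : ℕ) : ℤ) p = -1

/-- THE SPIN BIT of the labelled pair `(i, j)` read through a generator `g` of `𝔭_i`: `(π_i/𝔭_j)·((e_i − e_j)/p) = +1`, i.e.
`g(a_j)·(xnum446(a_i) − xnum446(a_j))` is a square mod `p` (both factors are prime to `p` for `p ∤ 2·223`, `i ≠ j`).
(Typer: carrier VERBATIM; K208.2: on the diagonal `i = i` the predicate is `IsSquare 0` = True — the rows' binder `i ≠ j` is LOAD-BEARING (without it 34-S would assert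
κ₀ = 1 at every pure prime; refuted by the κ₀ = 0 half).) -/
def SpinBitAtSplit (p : ℕ) (a : Fin 3 → ZMod p) (i j : Fin 3) (g : ℤ[X]) : Prop :=
  IsSquare (evalMod g p (a j) * (evalMod xnum446 p (a i) - evalMod xnum446 p (a j)))

/-! ### §34 rows -/

/-- **DESC-34-S `Curve446SplitPrimePureSpinLaw` (THE §34 THEOREM-CANDIDATE, beyond print; descent side).**  For `W = 446a1` on the rank-one odd branch,
every member `n = r·p·m` of the `ν = 0` split cell whose split factor `p` is PURE (every unit of `𝓞_L` is a square modulo every prime over `p`; in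
particular `p ≡ 1 (4)`), every labelling `a` of the primes over `p`, every `i ≠ j` and EVERY generator `g(θ)` of `𝔭_i`:
`κ₀(p) = 1 ⟺ (g(a_j)·(e_i − e_j) / p) = +1` — the residual Lagrangian bit is the quadratic residue symbol of a generator of one prime over `p` modulo a
CONJUGATE prime over `p` (an `S₃`-spin), corrected by the 2-torsion difference.  (Generator-independence is automatic under purity; label-independence
`(i,j) ↦` same bit is part of the claim = the parity lemma `A_I − A₁′ ∈ {0, Id}`.)
BC5 (ENGINE 49, kit j332000, `p ≤ 3000`): pure `ν = 0` split primes `997, 1109, 2957`: law holds `3/3` on all six `(i,j)` (`κ₀ = 1, 1, 0`); on ALL `14`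
`ν = 0` split primes `p ≤ 3000` the general identity with cofactor holds `14/14` (`84/84` pairs), `κ₀(ellrank) = κ₀(frame)` `14/14`, reciprocity `192/192`;
scale run kit j332044 (`p ≤ 40 000`) appended in MEMO-desc §34.  Why it might fail: a pure `p` at which the relaxed class `α_i` has odd valuation at a prime
over `2` or `223` (`w_i ∉ ⟨u₁,u₂⟩`; seen `0/42`).  [cite: FIMR2013Spin, Thm. 11.1 (cyclic cubic, prime twists)] [cite: MazurRubin2010, §3] [cite: Kramer1981, Prop. 6] [cite: PoonenRains2012, §4]
(Typer -ty g19, REF1-AUDIT §208: **SURVIVES**, `@[conjecture]` ✓ — THEOREM-CANDIDATE by §35-add1's descent; BC5 76/76 re-tallied independently (`retally.txt`: 446a1 3+12+61); `i ≠ j`, purity,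
generator-independence under purity all load-bearing and present.  REF2 v54 §11.2: NEW-COMBINATION (prior use of the lever: FIMR 2013 Thm. 11.1 = arXiv Thm. 28), statement NOT
IN PRINT.  R208d: the parity ⟹ position enumeration is kernel-certified (K208.6); the Poitou–Tate wrapper and `w_i ∈ ⟨u₁,u₂⟩` from the local conditions at 2, 223 are the
prover's work.  Cite brackets re-keyed (typer); FIMR «Prop. 12.4» of the sketch = arXiv Prop. 31.) -/
@[conjecture] def Curve446SplitPrimePureSpinLaw : Prop :=
  ∀ (W : WeierstrassCurve ℚ) [W.IsElliptic] [W.IsGloballyMinimal], IsCurve446a1 W → OnOddBranchRankOneAtTwo W →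
    ∀ n r p : ℕ, Curve446NuZeroSplitMember W n r p →
      ∀ a : Fin 3 → ZMod p, LabelledRootsMod p a → UnitsSquareModPrimesOver p a →
        ∀ i j : Fin 3, i ≠ j → ∀ g : ℤ[X], GeneratesPrimeOver p (a i) g →
          (KappaZeroAtSplit W n p ↔ SpinBitAtSplit p a i j g)

/-- **DESC-34-SF `Curve446SplitPrimeSpinTimesFrobenian` (theorem-candidate, the general `ν = 0` split prime: `κ₀ = SPIN × FROBENIAN`).**  There is a
function `Φ` of (`p mod 1784`, the generator triple `(g₁,g₂,g₃) mod 1784`, the signs of `g_j(θ)` at the three real places) — i.e. of the classes of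
`𝔭₁,𝔭₂,𝔭₃` in the ray class group of `L` modulo `1784·∞` — such that for every member of the `ν = 0` split cell, every labelling and every generator
triple: `κ₀(p) ⊕ [(g₁(a₂)(e₁ − e₂)/p) = +1] = Φ`.  (`Φ = {(−1/p)} + {(η w₁/𝔭₂)}`, `η = p/(π₁π₂π₃) ∈ 𝓞_L^×`, `w₁ ∈ ⟨u₁,u₂⟩` fixed by the local conditions
at `2, 223, ∞`; ENGINE 49 computes it by Hilbert symbols: identity `746/746` ν = 0 split `p ≤ 200 000`, `w_i ∈ ⟨u₁,u₂⟩` on `2 238/2 238` classes.)  BC5 (ENGINE 49b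
`an49b/ng49.py`, the invariant form of this row with the SHARPER modulus `8`): on the 4 325 pairs of ν = 0 split primes `p ≡ p' (mod 8)` whose generator triples can be
matched modulo `8𝓞_L` by totally positive units, the matched cofactor tables AGREE on 4 325/4 325 (while `κ₀` itself agrees on only 2 695/5 448 = 49 % of such pairs) — see
`Curve446SplitPrimeSpinTimesFrobenianModEight` below and the glue `spinTimesFrobenian_of_modEight`.  Why it might fail: `w₁` could depend on finer than `8·∞` (resp.
`1784·∞`) data of the `π_j` (it cannot if `α₁ ∈ π₂π₃·⟨u₁,u₂⟩`).  [cite: FIMR2013Spin, arXiv Prop. 31 (involution spins are residue symbols at a fixed modulus — «Prop. 12.4» in the sketch's numbering)]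
[cite: MazurRubin2010, §3]
(Typer, REF1 §208: **SURVIVES**, `@[conjecture]` ✓ (Φ WELL-DEFINED: key-determinacy needs «u ≡ □ mod 8𝓞_L and totally positive ⟹ u ∈ 𝓞_L^{×2}» — by C4 the only classes ≡ □ mod 4 are 1
and u₁u₂, and u₁u₂ is not totally positive ✓; the ∃Φ for the pair (0,1) and `g 0` only — other pairs by relabelling; ENGINE 49 SF 746/746 is -desc's tally, NOT re-tallied by
REF1, R208b(vi)).  REF2 v54 §11.2: NEW-COMBINATION; the transposition spins are FIMR arXiv Prop. 31-type (Frobenian given α mod 8 and signs) — WHY the cofactor is a ray-class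
function and `223 ∤` modulus.  `evalReal` ↦ `evalRealZ` (typer rename, see that carrier).) -/
@[conjecture] def Curve446SplitPrimeSpinTimesFrobenian : Prop :=
  ∀ (W : WeierstrassCurve ℚ) [W.IsElliptic] [W.IsGloballyMinimal], IsCurve446a1 W → OnOddBranchRankOneAtTwo W →
    ∃ Φ : (Fin 3 → ℤ[X]) → ℕ → Prop,
      (∀ (g g' : Fin 3 → ℤ[X]) (p p' : ℕ), (p : ZMod 1784) = (p' : ZMod 1784) →
          (∀ j, (g j).map (Int.castRingHom (ZMod 1784)) = (g' j).map (Int.castRingHom (ZMod 1784))) →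
          (∀ j, ∀ x : ℝ, evalRealZ cubic446 x = 0 → (0 < evalRealZ (g j) x ↔ 0 < evalRealZ (g' j) x)) →
            (Φ g p ↔ Φ g' p')) ∧
      ∀ n r p : ℕ, Curve446NuZeroSplitMember W n r p →
        ∀ a : Fin 3 → ZMod p, LabelledRootsMod p a →
          ∀ g : Fin 3 → ℤ[X], (∀ j, GeneratesPrimeOver p (a j) (g j)) →
            ((KappaZeroAtSplit W n p ↔ SpinBitAtSplit p a 0 1 (g 0)) ↔ Φ g p)

/-- **DESC-34-SF8 `Curve446SplitPrimeSpinTimesFrobenianModEight` (theorem-candidate; the SHARP form of DESC-34-SF suggested by the local analysis and by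
ENGINE 49b): the Frobenian cofactor `Φ` depends only on `p mod 8`, the generator triple modulo `8𝓞_L` and the real signs — i.e. on the classes of `𝔭₁,𝔭₂,𝔭₃` in the
ray class group of `L` modulo `8·∞` (the condition at `223` is unramifiedness only, `c₂₂₃(W) = 1`, so no `223`-adic residue information can enter; the `2`-adic square
classes of `L ⊗ ℚ₂ = ℚ₂ × L_{𝔮₂}` are determined modulo `𝔮₁³𝔮₂⁵ ⊇ 8𝓞_L`).  BC5: ENGINE 49b PHI TEST 4 325/4 325 at `N = 8` (and 2 122/2 122, 1 026/1 026, 505/505 at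
`N = 16, 32, 64`).  Why it might fail: a dependence on `p mod 16` not visible because … (none seen: the `N = 8` key already makes `Φ` constant).  Implies DESC-34-SF
(`spinTimesFrobenian_of_modEight`).
(Typer, REF1 §208: **SURVIVES**, `@[conjecture]` ✓ (ENGINE 49b PHI 4 325/4 325 at `N = 8` is -desc's tally, not re-tallied; SF8's «no 223-adic residue enters» is right for
unit-type classes: for α ∈ ker N at 223 = 𝔮₁𝔮₂² the norm condition forces the 𝔮₁-component into `ℚ₂₂₃^{×2}` — REF1 concurs with §34-add1).  REF2 §11.2: the expected shape, not an
accident.  Glue `spinTimesFrobenian_of_modEight` below (K208.8).  `evalReal` ↦ `evalRealZ`.) -/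
@[conjecture] def Curve446SplitPrimeSpinTimesFrobenianModEight : Prop :=
  ∀ (W : WeierstrassCurve ℚ) [W.IsElliptic] [W.IsGloballyMinimal], IsCurve446a1 W → OnOddBranchRankOneAtTwo W →
    ∃ Φ : (Fin 3 → ℤ[X]) → ℕ → Prop,
      (∀ (g g' : Fin 3 → ℤ[X]) (p p' : ℕ), (p : ZMod 8) = (p' : ZMod 8) →
          (∀ j, (g j).map (Int.castRingHom (ZMod 8)) = (g' j).map (Int.castRingHom (ZMod 8))) →
          (∀ j, ∀ x : ℝ, evalRealZ cubic446 x = 0 → (0 < evalRealZ (g j) x ↔ 0 < evalRealZ (g' j) x)) →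
            (Φ g p ↔ Φ g' p')) ∧
      ∀ n r p : ℕ, Curve446NuZeroSplitMember W n r p →
        ∀ a : Fin 3 → ZMod p, LabelledRootsMod p a →
          ∀ g : Fin 3 → ℤ[X], (∀ j, GeneratesPrimeOver p (a j) (g j)) →
            ((KappaZeroAtSplit W n p ↔ SpinBitAtSplit p a 0 1 (g 0)) ↔ Φ g p)

/-- Glue: the mod-`8` form implies the mod-`1784` form (`8 ∣ 1784`; congruence mod `1784` refines congruence mod `8`).
(Typer: -desc's glue VERBATIM modulo `evalReal` ↦ `evalRealZ`; REF1 §208 K208.8 re-checked it in the probe namespace.) -/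
theorem spinTimesFrobenian_of_modEight (h : Curve446SplitPrimeSpinTimesFrobenianModEight) :
    Curve446SplitPrimeSpinTimesFrobenian := by
  intro W _ _ hW hodd
  obtain ⟨Φ, hΦ, hlaw⟩ := h W hW hodd
  refine ⟨Φ, ?_, hlaw⟩
  intro g g' p p' hp hg hs
  have h8 : (8 : ℕ) ∣ 1784 := by norm_num
  apply hΦ g g' p p'
  · have := congrArg (ZMod.castHom h8 (ZMod 8)) hp
    simpa using this
  · intro j
    have hc : (ZMod.castHom h8 (ZMod 8)).comp (Int.castRingHom (ZMod 1784)) = Int.castRingHom (ZMod 8) :=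
      RingHom.ext_int _ _
    have := congrArg (Polynomial.map (ZMod.castHom h8 (ZMod 8))) (hg j)
    rw [Polynomial.map_map, Polynomial.map_map, hc] at this
    exact this
  · exact hs

/-- **DESC-34-NG `Curve446SplitPrimeKappaNotGoverned` (`@[conjecture]`, the negative half of the dichotomy: NO RAY-CLASS GOVERNING LAW for `κ₀`).**
For every modulus `N > 0` there are two members of the `ν = 0` split cell whose split factors `p, p'` carry labelled generator triples that are
congruent mod `N` coefficientwise with the same real signs (so `𝔭_j, 𝔭'_j` have the same class in the ray class group of `L` mod `N·∞`, and
`p ≡ p' (mod N)`), but `κ₀(p) ≠ κ₀(p')`.  With DESC-34-SF this says: the `S₃`-spin `(π₁/𝔭₂)` of the cubic field is governed by no ray class field —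
the analogue for `Gal = S₃`, `U⁺_L ≠ U_L²`, of [cite: KoymansMilovic2021Spins, Thm. 1 and Thm. 3] (there: `K/ℚ` Galois, `U⁺ = U²`, conditional on `C_n`).
Consequence under DESC-33-P: the SECOND 2-adic digit of the weight-3/2 coefficient `c(rpm)` of `446a1` has no governing field in `p` (contrast: `c(n) mod 2`
is Frobenian, §33 certificate).  BC5 (ENGINE 49b `an49b/ng49.py` on the ENGINE 49 tables, `p ≤ 200 000`): for `N = 4, 8, 16, 32, 64, 128` the ν = 0 split primes fall into `4/59/117/214/364/504` classes
(`p mod N` + the three generators modulo `N𝓞_L` up to totally positive units); same-class pairs `89 251/5 448/2 677/1 312/643/320`, of which `κ₀` DIFFERS on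
`44 706/2 753/1 376/688/338/166` (agreement `50/49/49/48/47/48 %` = coin) — each an explicit WITNESS for this `N` with totally positive generator triples of norms `p, p'`
congruent mod `N𝓞_L` (e.g. `N = 32`: `p = 4451` (`κ₀ = 1`), `p' = 7331` (`κ₀ = 0`)); `N` divisible by `223` is beyond collision range.  ENGINE 47/K33 (g24) had refuted the
fixed candidate fields `F₅, F₇`.  Why it might fail: only if the spin of conjugate primes in this `S₃` field were secretly Frobenian (it is not
for cyclic `K` by FIMR Thm. 1.1 under `C_n`).
(Typer -ty g19, REF1-AUDIT §208: **SURVIVES**, `@[conjecture]` ✓ — the guard `0 < N` is LOAD-BEARING (at `N = 0`, `ZMod 0 = ℤ` forces `p = p′`, `g = g′` and the body negates P48);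
C2: all 24/24 WITNESS blocks of `an49b/ng49-p200000.txt` (`N = 4 … 128`) verified independently — `p ≡ p′ (N)`, `|N(g_j)| = p`, `|N(g′_j)| = p′` by exact resultants, three
DISTINCT roots, `g_j ≡ g′_j` coefficientwise mod `N` (= mod `N𝓞_L` since `ℤ[θ] = 𝓞_L`, `deg ≤ 2`), total positivity certified at 700 decimal digits, `κ₀(p) ≠ κ₀(p′)` from the raw
F49 rows; the collision CLASS counts 4/59/117/214/364/504 were not re-tallied (R208b(vi)).  So BC5 is an honest ∃-witness per `N ∣ 128`; the `∀ N` row stays a CONJECTURE.  REF2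
v54 §11.3: shape IN PRINT = Koymans–Milovic Thm. 3 / FIMR Thm. 2; for THIS field (sextic S₃-closure, totally real, `U⁺ ≠ U²`) NO oscillation/equidistribution theorem is in
print, even conditionally — analytic input OPEN; KM's averaged spin `s_𝔞 = r(𝔞) Σ_t Σ_v r₊(tvα) ψ(tvα mod F) ∏ spin(σ, tvα)` is built to survive an ill-defined generator and SF8
says κ₀ has exactly that shape — the suggested research-grade route.  `evalReal` ↦ `evalRealZ`.) -/
@[conjecture] def Curve446SplitPrimeKappaNotGoverned : Prop :=
  ∀ (W : WeierstrassCurve ℚ) [W.IsElliptic] [W.IsGloballyMinimal], IsCurve446a1 W → OnOddBranchRankOneAtTwo W →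
    ∀ N : ℕ, 0 < N →
      ∃ (n r p n' r' p' : ℕ) (a : Fin 3 → ZMod p) (a' : Fin 3 → ZMod p') (g g' : Fin 3 → ℤ[X]),
        Curve446NuZeroSplitMember W n r p ∧ Curve446NuZeroSplitMember W n' r' p' ∧
        LabelledRootsMod p a ∧ LabelledRootsMod p' a' ∧
        (∀ j, GeneratesPrimeOver p (a j) (g j)) ∧ (∀ j, GeneratesPrimeOver p' (a' j) (g' j)) ∧
        (p : ZMod N) = (p' : ZMod N) ∧
        (∀ j, (g j).map (Int.castRingHom (ZMod N)) = (g' j).map (Int.castRingHom (ZMod N))) ∧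
        (∀ j, ∀ x : ℝ, evalRealZ cubic446 x = 0 → (0 < evalRealZ (g j) x ↔ 0 < evalRealZ (g' j) x)) ∧
        ¬ (KappaZeroAtSplit W n p ↔ KappaZeroAtSplit W n' p')

/-- **DESC-34-ν `Cubic446NuZeroLaw` (support, theorem-grade by class field theory once `s₃ ↔ u₁u₂` is identified; the meaning of `ν`).**  For an odd prime
`p ∤ 223` at which `cubic446` has three distinct roots: `T₃` has four roots mod `p` (`ν(p) = 0`, the constant class `s₃` is locally trivial at `p`)
`⟺ u₁u₂ = (θ² + θ − 3)(−3θ² − 5θ + 11)` is a square modulo each prime over `p` `⟺` each prime over `p` has a TOTALLY POSITIVE generator (is trivial in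
the narrow class group `Cl⁺(L) ≅ ℤ/2`).  ENGINE 49: `2 977/2 977` split `p ≤ 200 000` for both equivalences (`751` with `ν = 0`).  [cite: MazurRubin2010, §3]
(Typer -ty g19, REF1-AUDIT §208: **SURVIVES, THEOREM-GRADE support** (plain ✓).  C4: conjunct 1 («`T₃` totally split mod `p` ⟺ `u₁u₂` □ at all three roots») 2 977/2 977 split `p ≤ 200 000`
(ν = 0 at 751) on two engines; conjunct 2 (NEW REF1 test, signs certified at 300 digits) 2 977/2 977; **conjunct 2 ⟸ conjunct 1 by class field theory, unconditionally given
PARI's `h_L = 1`**: exactly one non-trivial class of `⟨−1,u₁,u₂⟩` is a square mod `4𝓞_L`, namely `u₁u₂ ≡ 1 (mod 4𝓞_L)` ⟹ `L(√(u₁u₂))/L` unramified at all finite primes,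
ramified at the two real places with `u₁u₂ < 0` ⟹ (`h_L = 1`, `h⁺_L = 2`) `L(√(u₁u₂))` = the narrow Hilbert class field, and «𝔭 principal-totally-positive ⟺ trivial in Cl⁺ ⟺
splits in the narrow HCF» is Artin reciprocity.  What remains for conjunct 1 as a THEOREM: the descent identity class(`T₃`) = `u₁u₂` in `(L^×/L^{×2})_{N=□}`.  REF2 v54 §11.4: CLASS
FIELD THEORY (print/CFT-grade); R208d(1): the CFT infrastructure is not in the tree — keep as support row.  `evalReal` ↦ `evalRealZ`; cite given its comma (typer).) -/
def Cubic446NuZeroLaw : Prop :=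
  ∀ p : ℕ, p.Prime → p ≠ 2 → p ≠ 223 → ∀ a : Fin 3 → ZMod p, LabelledRootsMod p a →
    (QuarticTotallySplitMod quarticT3 p ↔ ∀ j, IsSquare (evalMod (unitOne446 * unitTwo446) p (a j))) ∧
    (QuarticTotallySplitMod quarticT3 p ↔
      ∀ j, ∃ g : ℤ[X], GeneratesPrimeOver p (a j) g ∧ ∀ x : ℝ, evalRealZ cubic446 x = 0 → 0 < evalRealZ g x)

/-- **DESC-34-S_an `Curve446SplitPrimePureSpinShaAnLaw` (`@[conjecture]`, analytic twin of DESC-34-S: the parity of `#Ш_an` at the pure split-prime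
twists is the `S₃`-spin).**  Same members; for every globally minimal model `W'` of `W^{(−n)}` of analytic rank `0`, `#Ш_an(W')` is a non-zero rational `x`
and `(v₂(x) = 0 ⟺ (rm/p) = −1) ⟺` the spin bit.  (In Waldspurger currency: the second 2-adic digit of `c(rpm)`.)
(Typer, REF1 §208: **SURVIVES**, `@[conjecture]` (analytic twin; glue K208.9 below with hP = the landed §33 parity bridge `TwistShaAnOddIffSelmerTrivialAtTwo`); already in the R196a
currency (`∃ x : ℚ, … x ≠ 0 ∧ (padicValRat 2 x = 0 ↔ …)`).  Via DESC-33-P: the second 2-adic digit of the weight-3/2 coefficient `c(rpm)` of 446a1 is spin-type (REF2 §11.3,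
conjecture-grade; BSD not proved).) -/
@[conjecture] def Curve446SplitPrimePureSpinShaAnLaw : Prop :=
  ∀ (W : WeierstrassCurve ℚ) [W.IsElliptic] [W.IsGloballyMinimal], IsCurve446a1 W → OnOddBranchRankOneAtTwo W →
    ∀ n r p : ℕ, Curve446NuZeroSplitMember W n r p →
      ∀ a : Fin 3 → ZMod p, LabelledRootsMod p a → UnitsSquareModPrimesOver p a →
        ∀ i j : Fin 3, i ≠ j → ∀ g : ℤ[X], GeneratesPrimeOver p (a i) g →
          ∀ (W' : WeierstrassCurve ℚ) [W'.IsElliptic] [W'.IsGloballyMinimal],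
            (∃ C : VariableChange ℚ, C • W.quadraticTwist (-(n : ℚ)) = W') → W'.analyticRank = 0 →
              ∃ x : ℚ, shaAn W' = (x : ℂ) ∧ x ≠ 0 ∧
                ((padicValRat 2 x = 0 ↔ jacobiSym ((n / p : ℕ) : ℤ) p = -1) ↔ SpinBitAtSplit p a i j g)

/-- Kernel glue: the analytic spin law DESC-34-S_an follows from the descent spin law DESC-34-S and BSD₂-parity on the family DESC-33-P.
(Typer: -desc's glue VERBATIM; REF1 §208 K208.9 re-checked.) -/
theorem curve446PureSpinShaAnLaw_of_spinLaw_of_parity (hS : Curve446SplitPrimePureSpinLaw) (hP : TwistShaAnOddIffSelmerTrivialAtTwo) :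
    Curve446SplitPrimePureSpinShaAnLaw := by
  intro W _ _ h446 hbr n r p hmem a ha hpure i j hij g hg W' _ _ hC hrk
  obtain ⟨x, hx, hx0, hiff⟩ := hP W hbr n hmem.1 W' hC hrk
  refine ⟨x, hx, hx0, ?_⟩
  have hlaw := hS W h446 hbr n r p hmem a ha hpure i j hij g hg
  unfold KappaZeroAtSplit at hlaw
  constructor
  · intro h
    exact hlaw.mp (hiff.symm.trans h)
  · intro h
    exact hiff.trans (hlaw.mpr h)

end Summit.BirchSwinnertonDyer.Rank1Residual.F1Sign2

end
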